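import Summits.QuantumFields.QCD.Theorems.SpectralDefectExtinctionWindowExtinctionCornerTwoLineDecay
import Summits.QuantumFields.QCD.Theorems.SpectralDefectExtinctionWindowExtinctionCornerDeepOfTwoLine
import Summits.QuantumFields.QCD.Theorems.SpectralDefectExtinctionWindowExtinctionCornerStubSchurCount

/-!
# DEEP-BAND EXTINCTION, unconditional (line `corner-decorrelation-deep-hole`, S1 ∧ S2 ∧ S3 composed)
(crux `Summit.QuantumFields.QCD.Theses.SpectralDefectExtinction.WindowExtinction`, item stmt-QuantumFields-18063)

With S1 (`stub_schurCount`, p146544), S2 (`stub_twoLineDecay`, p801891) and S3 (`stub_deepOfTwoLine`, p147094)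
all landed, the line's mechanism is a THEOREM: for `N_f ≤ 3` and every asymptotically scaling, polynomially capped,
branched Wilson regularisation there is an absolute depth constant `c₁ > 0` (that of S2) such that for all masses
`m > M₀ ≥ 0` and `ε > 0`, eventually in `k`, on every odd torus `2S+1 ≥ 2L_k+1`, the phase-quenched expected number
of characteristic roots `z` of `D_W(U,0,1)` in the DEEP BAND `|4 − z| ≥ 4 − c₁/(2β_k)` (which contains every real
root `≤ c₁/(2β_k)`, and every near-eigenvalue disc there) is `≤ ε ((2S+1)/(2L_k+1))⁴`.  This is the deep part of
clause EXTINCT (a) of the crux, for EVERY admissible line, with no reflection positivity, no cluster expansion, no RG.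
What remains of the crux is the near-edge band + TIGHT⁺ (S4) and the coercivity window (S5, given `WegnerEstimate`).
-/

noncomputable section

namespace Summit.QuantumFields.QCD.Cruxes.WindowExtinction.CornerDecorrelationDeepHole

open scoped BigOperators Matrix
open Filter MeasureTheory
open Literature.MathematicalPhysics.QuantumLattice Literature.MathematicalPhysics.QuantumFieldTheory
  Literature.Probability.LatticeModels

/-- **Deep-band extinction along every asymptotically scaling, capped, branched regularisation (`N_f ≤ 3`).**
The depth constant `c₁` is absolute (it is the two-line decay rate of S2). -/
theorem cornerDeepBandExtinction : ∃ c₁ : ℝ, 0 < c₁ ∧ ∀ Nf : ℕ, Nf ≤ 3 → ∀ (reg : QCDRegularisation Nf) (M₀ : ℝ),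
    0 ≤ M₀ → (reg.scheme 0 0 0).HasAsymptoticScaling →
    (∃ p : ℕ, ∀ᶠ k : ℕ in Filter.atTop, (reg.L k : ℝ) ≤ (reg.a k)⁻¹ ^ p) →
    (∀ᶠ k : ℕ in Filter.atTop, -1 < reg.mcrit k) →
    ∀ m : Fin Nf → ℝ, (∀ f, M₀ < m f) → ∀ ε : ℝ, 0 < ε → ∀ᶠ k : ℕ in Filter.atTop, ∀ S : ℕ, reg.L k ≤ S → (∫ U, (Multiset.countP (fun z : ℂ => 4 - c₁ / (2 * reg.β k) ≤ ‖(4 : ℂ) - z‖) (wilsonDirac (fundamentalRep (Fin 3)) U 0 1).charpoly.roots : ℝ) * ∏ f : Fin Nf, ‖fermionDet (wilsonDirac (fundamentalRep (Fin 3)) U (reg.mcrit k + reg.a k * m f / reg.Zm k) 1)‖ ∂(wilsonMeasure (d := 4) (L := 2 * S + 1) (fundamentalRep (Fin 3)) (reg.β k))) / (∫ U, ∏ f : Fin Nf, ‖fermionDet (wilsonDirac (fundamentalRep (Fin 3)) U (reg.mcrit k + reg.a k * m f / reg.Zm k) 1)‖ ∂(wilsonMeasure (d := 4) (L := 2 *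 S + 1) (fundamentalRep (Fin 3)) (reg.β k))) ≤ ε * ((2 * S + 1 : ℝ) / (2 * reg.L k + 1)) ^ 4 := by
  obtain ⟨c₁, C, C₀, hc₁, hC, hC₀, hlev⟩ := stub_twoLineDecay
  refine ⟨c₁, hc₁, fun Nf hNf reg M₀ hM₀ hAS hcap hbr => ?_⟩
  exact stub_deepOfTwoLine stub_schurCount Nf (hNf.trans (by norm_num)) reg c₁ C C₀ M₀ hc₁ hC hC₀ hM₀ hAS hcap hbr
    (hlev Nf hNf)

end Summit.QuantumFields.QCD.Cruxes.WindowExtinction.CornerDecorrelationDeepHole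

end
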